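import Summits.CriticalPhenomena.PercolationContinuityZ3.Theorems.PercNearOneGluingNoHeavyLowerTailSahiGridPatternWForm
import Summits.CriticalPhenomena.PercolationContinuityZ3.Theorems.PercNearOneGluingNoHeavyLowerTailSahiGridPatternFaces

/-!
# `NoHeavyLowerTail` (crux stmt-CriticalPhenomena-4575), Sahi programme: **THEOREM R — ADDING A BOTTOM POINT OUTSIDE THE OTHER TWO BOTTOMS NEVER
# INCREASES THE UPPER-STEP FUNCTIONAL (every dimension); COMB-M⁺ reduces to IRREDUCIBLE nested pairs**

Support file (seat `prim-ineq-gen-4`, generation 14; `--supports stmt-CriticalPhenomena-4575`).  Pure proofs, no definitions, no `sorry`, standard axioms.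
Vocabulary and machinery of `…SahiGridPattern{WForm,Faces,TwoLayerTop,TwoSetsTop,Kleitman,Harris}`.

THE MATHEMATICS.  Let `Au, Bu, Cu ⊆ [3]^{n+1}` be an upper-step triple (level-`1` slice = level-`2` slice) with `Au, Bu` up-sets, slices `A⁰ ⊆ A²`, `B⁰ ⊆ B²`,
`C⁰`, `C²`, and let `w : [3]^n` be a point whose level-`0` copy `(w,0)` is NOT in `Cu`.  Put `Cu' := insert (w,0) Cu` (the `C`-bottom grows by the point `w`; `Cu'` is
again upper-step with the same top slice).  The W-form (`…WForm`) with the `C`-slot distinguished is AFFINE in the `C`-bottom, and the coefficient of the point `w` is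
(`sStarD_insert_bottom_eq`):
  `sStarD Au Bu Cu' − sStarD Au Bu Cu = −2·( 1_{B⁰}(w)·|A²|_w + 1_{A⁰}(w)·|B²|_w + [|A²∩B²|_w − Λ_w(A²,B²)] ) + 4·2^n·1_{A⁰}(w)1_{B⁰}(w)`
(`|X|_w = #{p ∈ X : p totally distinct from w}`, `Λ_w(A²,B²) = #{q ∈ A² : q t.d. w, thirdPt q w ∈ B²}`; the bracket is a fibre-Kleitman gap, `≥ 0` by `sum_fibre_third_le`).
Hence **THEOREM R** (`sStarD_insert_bottom_le`): if `(w,0) ∉ Au ∩ Bu` (the new bottom point is not in both other BOTTOMS) then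
  **`sStarD Au Bu (insert (w,0) Cu) ≤ sStarD Au Bu Cu`.**
CONSEQUENCE (reduction to irreducible pairs): for a nested pair `β = (A,B,C) ⊆ τ` of up-set triples and a MAXIMAL element `w` of the increment `c = C′∖C` with `w ∉ A∩B`,
`(A,B,C∪{w})` is again a nested pair of up-sets with the same top and a smaller-or-equal slack `c₂ − c₃`; iterating (in all three slots), every pair dominates an
IRREDUCIBLE one (`max(a) ⊆ B∩C`, `max(b) ⊆ A∩C`, `max(c) ⊆ A∩B`) with the same `c₃`: COMB-M⁺, the sharp-constant conjecture `4c₂ ≥ 7c₃` and every extremal ratio `c₂/c₃` need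
only be examined on irreducible pairs (2.43 % of the `m = 4` cells, 0.18 % of random `m = 5` nested triples; memo `run/shared/lean/prim/prim-ineq-gen-4/FINDING-W-FORM-g14.md` (R)).
HONEST LABEL: COMB-M⁺ in general, `PatternPos d` (`d ≥ 4`), Sahi's `C₃` and Kahn's conjecture remain OPEN; nothing here asserts them. [this work]
-/

namespace Summit.CriticalPhenomena.PercolationContinuityZ3.Theorems.SahiGridPattern

open Finset SahiGrid3
open scoped BigOperators

variable {n : ℕ}

/-- Indicator of `insert w S` off `S`. [this work] -/
theorem ind_insert_of_not_mem {S : Finset (Pd n)} {w : Pd n} (hw : w ∉ S) (q : Pd n) :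
    ind (insert w S) q = ind S q + (if q = w then (1:ℤ) else 0) := by
  unfold ind
  by_cases h1 : q = w
  · subst h1; simp [hw]
  · by_cases h2 : q ∈ S <;> simp [h1, h2]

/-- Indicator of a singleton. [this work] -/
theorem ind_singleton_eq (w q : Pd n) : ind ({w} : Finset (Pd n)) q = (if q = w then (1:ℤ) else 0) := by
  unfold ind; simp only [mem_singleton]

/-- Splitting a pair count whose middle indicator is `insert w S`. [this work] -/
theorem sum_pair_insert_mid {S : Finset (Pd n)} {w : Pd n} (hw : w ∉ S) (f g : Pd n → ℤ) :
    (∑ p, ∑ q, f p * ind (insert w S) q * g q * (if TotDist p q = true then (1:ℤ) else 0)) =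
      (∑ p, ∑ q, f p * ind S q * g q * (if TotDist p q = true then (1:ℤ) else 0)) + g w * (∑ p, f p * (if TotDist p w = true then (1:ℤ) else 0)) := by
  rw [Finset.mul_sum, ← Finset.sum_add_distrib]
  refine Finset.sum_congr rfl fun p _ => ?_
  have e : ∀ q, f p * ind (insert w S) q * g q * (if TotDist p q = true then (1:ℤ) else 0) = f p * ind S q * g q * (if TotDist p q = true then (1:ℤ) else 0) + (if q = w then f p * g q * (if TotDist p q = true then (1:ℤ) else 0) else 0) := by
    intro q; rw [ind_insert_of_not_mem hw q]; split_ifs <;> ring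
  rw [Finset.sum_congr rfl fun q _ => e q, Finset.sum_add_distrib, Finset.sum_ite_eq' univ w, if_pos (mem_univ w)]
  ring

/-- Splitting a diagonal count whose first indicator is `insert w S`. [this work] -/
theorem sum_diag_insert_first {S : Finset (Pd n)} {w : Pd n} (hw : w ∉ S) (f g : Pd n → ℤ) :
    (∑ p, ind (insert w S) p * f p * g p) = (∑ p, ind S p * f p * g p) + f w * g w := by
  have e : ∀ p, ind (insert w S) p * f p * g p = ind S p * f p * g p + (if p = w then f p * g p else 0) := by
    intro p; rw [ind_insert_of_not_mem hw p]; split_ifs <;> ring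
  rw [Finset.sum_congr rfl fun p _ => e p, Finset.sum_add_distrib, Finset.sum_ite_eq' univ w, if_pos (mem_univ w)]

/-- `sStarD` is additive in its first argument over `insert`. [this work] -/
theorem sStarD_insert_first {S : Finset (Pd n)} {w : Pd n} (hw : w ∉ S) (Y Z : Finset (Pd n)) :
    sStarD (insert w S) Y Z = sStarD ({w} : Finset (Pd n)) Y Z + sStarD S Y Z := by
  rw [sStarD_eq_sum_tcD, sStarD_eq_sum_tcD, sStarD_eq_sum_tcD, Finset.sum_insert hw, Finset.sum_singleton]

/-- The pattern functional with a SINGLETON first argument, in fibre counts at `w`: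
`sStarD {w} Y Z = 2·2^n·Y(w)Z(w) − |Y∩Z|_w − Z(w)|Y|_w − Y(w)|Z|_w + Λ_w(Y,Z)`. [this work] -/
theorem sStarD_singleton_first (w : Pd n) (Y Z : Finset (Pd n)) :
    sStarD ({w} : Finset (Pd n)) Y Z = 2 * 2 ^ n * (ind Y w * ind Z w) - (∑ q, (if TotDist q w = true then (1:ℤ) else 0) * (ind Y q * ind Z q))
      - ind Z w * (∑ p, ind Y p * (if TotDist p w = true then (1:ℤ) else 0)) - ind Y w * (∑ p, ind Z p * (if TotDist p w = true then (1:ℤ) else 0)) + (∑ q, (if TotDist q w = true then (1:ℤ) else 0) * (ind Y q * ind Z (thirdPt q w))) := by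
  rw [sStarD_counting]
  have t1 : (∑ p, ind ({w} : Finset (Pd n)) p * ind Y p * ind Z p) = ind Y w * ind Z w := by
    have e : ∀ p, ind ({w} : Finset (Pd n)) p * ind Y p * ind Z p = (if p = w then ind Y p * ind Z p else 0) := by
      intro p; rw [ind_singleton_eq]; split_ifs <;> ring
    rw [Finset.sum_congr rfl fun p _ => e p, Finset.sum_ite_eq' univ w, if_pos (mem_univ w)]
  have t2 : (∑ p, ∑ q, ind ({w} : Finset (Pd n)) p * ind Y q * ind Z q * (if TotDist p q = true then (1:ℤ) else 0)) = ∑ q, (if TotDist q w = true then (1:ℤ) else 0) * (ind Y q * ind Z q) := by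
    have e : ∀ p, (∑ q, ind ({w} : Finset (Pd n)) p * ind Y q * ind Z q * (if TotDist p q = true then (1:ℤ) else 0)) = (if p = w then (∑ q, ind Y q * ind Z q * (if TotDist p q = true then (1:ℤ) else 0)) else 0) := by
      intro p; rw [ind_singleton_eq]; split_ifs with h
      · exact Finset.sum_congr rfl fun q _ => by ring
      · exact Finset.sum_eq_zero fun q _ => by ring
    rw [Finset.sum_congr rfl fun p _ => e p, Finset.sum_ite_eq' univ w, if_pos (mem_univ w)]
    exact Finset.sum_congr rfl fun q _ => by rw [totDist_symm w q]; ring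
  have t3 : (∑ p, ∑ q, ind Y p * ind ({w} : Finset (Pd n)) q * ind Z q * (if TotDist p q = true then (1:ℤ) else 0)) = ind Z w * (∑ p, ind Y p * (if TotDist p w = true then (1:ℤ) else 0)) := by
    rw [Finset.mul_sum]
    refine Finset.sum_congr rfl fun p _ => ?_
    have e : ∀ q, ind Y p * ind ({w} : Finset (Pd n)) q * ind Z q * (if TotDist p q = true then (1:ℤ) else 0) = (if q = w then ind Y p * ind Z q * (if TotDist p q = true then (1:ℤ) else 0) else 0) := by
      intro q; rw [ind_singleton_eq]; split_ifs <;> ring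
    rw [Finset.sum_congr rfl fun q _ => e q, Finset.sum_ite_eq' univ w, if_pos (mem_univ w)]; ring
  have t4 : (∑ p, ∑ q, ind Z p * ind ({w} : Finset (Pd n)) q * ind Y q * (if TotDist p q = true then (1:ℤ) else 0)) = ind Y w * (∑ p, ind Z p * (if TotDist p w = true then (1:ℤ) else 0)) := by
    rw [Finset.mul_sum]
    refine Finset.sum_congr rfl fun p _ => ?_
    have e : ∀ q, ind Z p * ind ({w} : Finset (Pd n)) q * ind Y q * (if TotDist p q = true then (1:ℤ) else 0) = (if q = w then ind Z p * ind Y q * (if TotDist p q = true then (1:ℤ) else 0) else 0) := by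
      intro q; rw [ind_singleton_eq]; split_ifs <;> ring
    rw [Finset.sum_congr rfl fun q _ => e q, Finset.sum_ite_eq' univ w, if_pos (mem_univ w)]; ring
  have t5 : (∑ q, ∑ r, ind Y q * ind Z r * ind ({w} : Finset (Pd n)) (thirdPt q r) * (if TotDist q r = true then (1:ℤ) else 0)) =
      ∑ q, (if TotDist q w = true then (1:ℤ) else 0) * (ind Y q * ind Z (thirdPt q w)) := by
    refine Finset.sum_congr rfl fun q _ => ?_
    have hiff : ∀ r, thirdPt q r = w ↔ r = thirdPt q w := fun r =>
      ⟨fun h => by rw [← h, thirdPt_thirdPt], fun h => by rw [h, thirdPt_thirdPt]⟩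
    have e : ∀ r, ind Y q * ind Z r * ind ({w} : Finset (Pd n)) (thirdPt q r) * (if TotDist q r = true then (1:ℤ) else 0) =
        (if r = thirdPt q w then ind Y q * ind Z r * (if TotDist q r = true then (1:ℤ) else 0) else 0) := by
      intro r; rw [ind_singleton_eq]
      by_cases h : r = thirdPt q w
      · rw [if_pos ((hiff r).2 h), if_pos h]; ring
      · rw [if_neg (fun h' => h ((hiff r).1 h')), if_neg h]; ring
    rw [Finset.sum_congr rfl fun r _ => e r, Finset.sum_ite_eq' univ (thirdPt q w), if_pos (mem_univ _), totDist_thirdPt_right]; ring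
  rw [t1, t2, t3, t4, t5]

/-- **THE COEFFICIENT OF ONE BOTTOM POINT** (every `n`; identity): for an upper-step triple `Au, Bu, Cu` and a point `w` with `(w,0) ∉ Cu`,
`sStarD Au Bu (insert (w,0) Cu) − sStarD Au Bu Cu = −2·(1_{B⁰}(w)|A²|_w + 1_{A⁰}(w)|B²|_w + |A²B²|_w − Λ_w(A²,B²)) + 4·2^n·1_{A⁰}(w)1_{B⁰}(w)`. [this work] -/
theorem sStarD_insert_bottom_eq (Au Bu Cu : Finset (Pd (n + 1))) (w : Pd n)
    (hAu : ∀ q : Pd n, ind Au (Fin.snoc q 1 : Pd (n + 1)) = ind Au (Fin.snoc q 2 : Pd (n + 1)))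
    (hBu : ∀ q : Pd n, ind Bu (Fin.snoc q 1 : Pd (n + 1)) = ind Bu (Fin.snoc q 2 : Pd (n + 1)))
    (hCu : ∀ q : Pd n, ind Cu (Fin.snoc q 1 : Pd (n + 1)) = ind Cu (Fin.snoc q 2 : Pd (n + 1)))
    (hw : (Fin.snoc w 0 : Pd (n + 1)) ∉ Cu) :
    sStarD Au Bu (insert (Fin.snoc w 0 : Pd (n + 1)) Cu) - sStarD Au Bu Cu =
      -2 * (ind (univ.filter fun q : Pd n => (Fin.snoc q 0 : Pd (n + 1)) ∈ Bu) w * (∑ p, ind (univ.filter fun q : Pd n => (Fin.snoc q 2 : Pd (n + 1)) ∈ Au) p * (if TotDist p w = true then (1:ℤ) else 0)) + ind (univ.filter fun q : Pd n => (Fin.snoc q 0 : Pd (n + 1)) ∈ Au) w * (∑ p, ind (univ.filter fun q : Pd n => (Fin.snoc q 2 : Pd (n + 1)) ∈ Bu) p * (if TotDist p w = true then (1:ℤ) else 0)) + ((∑ q, (if TotDist q w = true then (1:ℤ) else 0) * (ind (univ.filter fun q : Pd n => (Fin.snoc q 2 : Pd (n + 1)) ∈ Au) q * ind (univ.filter fun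 q : Pd n => (Fin.snoc q 2 : Pd (n + 1)) ∈ Bu) q)) - (∑ q, (if TotDist q w = true then (1:ℤ) else 0) * (ind (univ.filter fun q : Pd n => (Fin.snoc q 2 : Pd (n + 1)) ∈ Au) q * ind (univ.filter fun q : Pd n => (Fin.snoc q 2 : Pd (n + 1)) ∈ Bu) (thirdPt q w)))))
      + 4 * 2 ^ n * (ind (univ.filter fun q : Pd n => (Fin.snoc q 0 : Pd (n + 1)) ∈ Au) w * ind (univ.filter fun q : Pd n => (Fin.snoc q 0 : Pd (n + 1)) ∈ Bu) w) := by
  -- the slices of Cu' = insert (w,0) Cu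
  have hne2 : ∀ q : Pd n, (Fin.snoc q 2 : Pd (n + 1)) ≠ Fin.snoc w 0 := fun q h => by
    have := congrFun h (Fin.last n); simp [Fin.snoc_last] at this
  have hne1 : ∀ q : Pd n, (Fin.snoc q 1 : Pd (n + 1)) ≠ Fin.snoc w 0 := fun q h => by
    have := congrFun h (Fin.last n); simp [Fin.snoc_last] at this
  have hinj : ∀ q : Pd n, (Fin.snoc q 0 : Pd (n + 1)) = Fin.snoc w 0 → q = w := fun q h => by
    funext a; have := congrFun h (Fin.castSucc a); simpa [Fin.snoc_castSucc] using this
  have e2 : (univ.filter fun q : Pd n => (Fin.snoc q 2 : Pd (n + 1)) ∈ insert (Fin.snoc w 0 : Pd (n + 1)) Cu) = (univ.filter fun q : Pd n => (Fin.snoc q 2 : Pd (n + 1)) ∈ Cu) := by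
    ext q; simp only [mem_filter, mem_univ, true_and, mem_insert, hne2 q, false_or]
  have hwC0 : w ∉ (univ.filter fun q : Pd n => (Fin.snoc q 0 : Pd (n + 1)) ∈ Cu) := fun h => hw (mem_filter.1 h).2
  have e0 : (univ.filter fun q : Pd n => (Fin.snoc q 0 : Pd (n + 1)) ∈ insert (Fin.snoc w 0 : Pd (n + 1)) Cu) = (insert w (univ.filter fun q : Pd n => (Fin.snoc q 0 : Pd (n + 1)) ∈ Cu)) := by
    ext q; simp only [mem_filter, mem_univ, true_and, mem_insert]
    constructor
    · rintro (h | h)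
      · exact Or.inl (hinj q h)
      · exact Or.inr h
    · rintro (h | h)
      · exact Or.inl (by rw [h])
      · exact Or.inr h
  have hCu' : ∀ q : Pd n, ind (insert (Fin.snoc w 0 : Pd (n + 1)) Cu) (Fin.snoc q 1 : Pd (n + 1)) = ind (insert (Fin.snoc w 0 : Pd (n + 1)) Cu) (Fin.snoc q 2 : Pd (n + 1)) := by
    intro q; have h := hCu q; unfold ind at h ⊢
    simp only [mem_insert, hne1 q, hne2 q, false_or]; exact h
  have eW := sStarD_upperStep_wForm Cu Au Bu hCu hAu hBu
  have eW' := sStarD_upperStep_wForm (insert (Fin.snoc w 0 : Pd (n + 1)) Cu) Au Bu hCu' hAu hBu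
  rw [e0, e2] at eW'
  -- split the atoms that contain the C-bottom
  have s1 := sum_pair_insert_mid hwC0 (ind (univ.filter fun q : Pd n => (Fin.snoc q 2 : Pd (n + 1)) ∈ Au)) (ind (univ.filter fun q : Pd n => (Fin.snoc q 2 : Pd (n + 1)) ∈ Bu))
  have s2 := sum_pair_insert_mid hwC0 (ind (univ.filter fun q : Pd n => (Fin.snoc q 2 : Pd (n + 1)) ∈ Au)) (ind (univ.filter fun q : Pd n => (Fin.snoc q 0 : Pd (n + 1)) ∈ Bu))
  have s3 := sum_pair_insert_mid hwC0 (ind (univ.filter fun q : Pd n => (Fin.snoc q 2 : Pd (n + 1)) ∈ Bu)) (ind (univ.filter fun q : Pd n => (Fin.snoc q 2 : Pd (n + 1)) ∈ Au))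
  have s4 := sum_pair_insert_mid hwC0 (ind (univ.filter fun q : Pd n => (Fin.snoc q 2 : Pd (n + 1)) ∈ Bu)) (ind (univ.filter fun q : Pd n => (Fin.snoc q 0 : Pd (n + 1)) ∈ Au))
  have s5 := sum_diag_insert_first hwC0 (ind (univ.filter fun q : Pd n => (Fin.snoc q 2 : Pd (n + 1)) ∈ Au)) (ind (univ.filter fun q : Pd n => (Fin.snoc q 2 : Pd (n + 1)) ∈ Bu))
  have s6 := sum_diag_insert_first hwC0 (ind (univ.filter fun q : Pd n => (Fin.snoc q 0 : Pd (n + 1)) ∈ Au)) (ind (univ.filter fun q : Pd n => (Fin.snoc q 0 : Pd (n + 1)) ∈ Bu))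
  have s7 := sStarD_insert_first hwC0 (univ.filter fun q : Pd n => (Fin.snoc q 2 : Pd (n + 1)) ∈ Au) (univ.filter fun q : Pd n => (Fin.snoc q 2 : Pd (n + 1)) ∈ Bu)
  have s8 := sStarD_singleton_first w (univ.filter fun q : Pd n => (Fin.snoc q 2 : Pd (n + 1)) ∈ Au) (univ.filter fun q : Pd n => (Fin.snoc q 2 : Pd (n + 1)) ∈ Bu)
  -- the conclusion talks about sStarD Au Bu ·; the W-form about sStarD · Au Bu
  have cv : ∀ X : Finset (Pd (n + 1)), sStarD X Au Bu = sStarD Au Bu X := fun X => by rw [sStarD_swap12 X Au Bu, sStarD_swap23 Au X Bu]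
  rw [← cv, ← cv]
  rw [s7, s8, s1, s2, s3, s4, s5, s6] at eW'
  linarith [eW, eW']

/-- **THEOREM R** (every `n`): for an upper-step triple `Au, Bu, Cu ⊆ [3]^{n+1}` with `Au, Bu` up-sets and a point `w` with `(w,0) ∉ Cu` and `(w,0) ∉ Au ∩ Bu`
(the new bottom point does not lie in both other bottoms), ENLARGING the `C`-bottom by `w` does not increase the functional:
`sStarD Au Bu (insert (w,0) Cu) ≤ sStarD Au Bu Cu`.  Equivalently (same top triple): the upper-step slack `c₂ − c₃` of the nested pair `(A,B,C) ⊆ τ` is at least that of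
`(A,B,C∪{w}) ⊆ τ` — COMB-M⁺ and all lower bounds for `c₂ − c₃` at fixed `τ` reduce to IRREDUCIBLE pairs. [this work] -/
theorem sStarD_insert_bottom_le (Au Bu Cu : Finset (Pd (n + 1))) (w : Pd n)
    (hA : IsUpperSet (Au : Set (Pd (n + 1)))) (hB : IsUpperSet (Bu : Set (Pd (n + 1))))
    (hAu : ∀ q : Pd n, ind Au (Fin.snoc q 1 : Pd (n + 1)) = ind Au (Fin.snoc q 2 : Pd (n + 1)))
    (hBu : ∀ q : Pd n, ind Bu (Fin.snoc q 1 : Pd (n + 1)) = ind Bu (Fin.snoc q 2 : Pd (n + 1)))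
    (hCu : ∀ q : Pd n, ind Cu (Fin.snoc q 1 : Pd (n + 1)) = ind Cu (Fin.snoc q 2 : Pd (n + 1)))
    (hw : (Fin.snoc w 0 : Pd (n + 1)) ∉ Cu)
    (hwAB : ¬ ((Fin.snoc w 0 : Pd (n + 1)) ∈ Au ∧ (Fin.snoc w 0 : Pd (n + 1)) ∈ Bu)) :
    sStarD Au Bu (insert (Fin.snoc w 0 : Pd (n + 1)) Cu) ≤ sStarD Au Bu Cu := by
  have e := sStarD_insert_bottom_eq Au Bu Cu w hAu hBu hCu hw
  have hA2up : IsUpperSet (((univ.filter fun q : Pd n => (Fin.snoc q 2 : Pd (n + 1)) ∈ Au) : Finset (Pd n)) : Set (Pd n)) := isUpperSet_filter_snoc hA 2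
  have hB2up : IsUpperSet (((univ.filter fun q : Pd n => (Fin.snoc q 2 : Pd (n + 1)) ∈ Bu) : Finset (Pd n)) : Set (Pd n)) := isUpperSet_filter_snoc hB 2
  have key : (∑ q, (if TotDist q w = true then (1:ℤ) else 0) * (ind (univ.filter fun q : Pd n => (Fin.snoc q 2 : Pd (n + 1)) ∈ Au) q * ind (univ.filter fun q : Pd n => (Fin.snoc q 2 : Pd (n + 1)) ∈ Bu) (thirdPt q w))) ≤ (∑ q, (if TotDist q w = true then (1:ℤ) else 0) * (ind (univ.filter fun q : Pd n => (Fin.snoc q 2 : Pd (n + 1)) ∈ Au) q * ind (univ.filter fun q : Pd n => (Fin.snoc q 2 : Pd (n + 1)) ∈ Bu) q)) := sum_fibre_third_le hA2up hB2up w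
  have hz : ind (univ.filter fun q : Pd n => (Fin.snoc q 0 : Pd (n + 1)) ∈ Au) w * ind (univ.filter fun q : Pd n => (Fin.snoc q 0 : Pd (n + 1)) ∈ Bu) w = 0 := by
    unfold ind
    by_cases ha : w ∈ (univ.filter fun q : Pd n => (Fin.snoc q 0 : Pd (n + 1)) ∈ Au)
    · have hb : w ∉ (univ.filter fun q : Pd n => (Fin.snoc q 0 : Pd (n + 1)) ∈ Bu) := fun hb => hwAB ⟨(mem_filter.1 ha).2, (mem_filter.1 hb).2⟩
      rw [if_neg hb, mul_zero]
    · rw [if_neg ha, zero_mul]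
  have hz' : (2:ℤ) ^ n * (ind (univ.filter fun q : Pd n => (Fin.snoc q 0 : Pd (n + 1)) ∈ Au) w * ind (univ.filter fun q : Pd n => (Fin.snoc q 0 : Pd (n + 1)) ∈ Bu) w) = 0 := by rw [hz, mul_zero]
  have SA0 : 0 ≤ (∑ p, ind (univ.filter fun q : Pd n => (Fin.snoc q 2 : Pd (n + 1)) ∈ Au) p * (if TotDist p w = true then (1:ℤ) else 0)) := Finset.sum_nonneg fun p _ => mul_nonneg (ind_nonneg' _ _) (by split_ifs <;> norm_num)
  have SB0 : 0 ≤ (∑ p, ind (univ.filter fun q : Pd n => (Fin.snoc q 2 : Pd (n + 1)) ∈ Bu) p * (if TotDist p w = true then (1:ℤ) else 0)) := Finset.sum_nonneg fun p _ => mul_nonneg (ind_nonneg' _ _) (by split_ifs <;> norm_num)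
  have p1 : 0 ≤ ind (univ.filter fun q : Pd n => (Fin.snoc q 0 : Pd (n + 1)) ∈ Bu) w * (∑ p, ind (univ.filter fun q : Pd n => (Fin.snoc q 2 : Pd (n + 1)) ∈ Au) p * (if TotDist p w = true then (1:ℤ) else 0)) := mul_nonneg (ind_nonneg' _ _) SA0
  have p2 : 0 ≤ ind (univ.filter fun q : Pd n => (Fin.snoc q 0 : Pd (n + 1)) ∈ Au) w * (∑ p, ind (univ.filter fun q : Pd n => (Fin.snoc q 2 : Pd (n + 1)) ∈ Bu) p * (if TotDist p w = true then (1:ℤ) else 0)) := mul_nonneg (ind_nonneg' _ _) SB0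
  nlinarith [e, key, hz', p1, p2]

/-- **THEOREM R″** (every `n`): if the new bottom point lies in BOTH other bottoms (`(w,0) ∈ Au ∩ Bu`), adding it to the `C`-bottom INCREASES the functional:
`sStarD Au Bu Cu ≤ sStarD Au Bu (insert (w,0) Cu)` — the coefficient is `2·P_w(A²,B²) ≥ 0`, the y-profile of the two other tops at a point of their meet.
Equivalently: deleting from a bottom slice a (minimal) point that lies in both other bottom slices never increases the upper-step slack, so COMB-M⁺ for `(A,B,C) ⊆ τ`
follows from COMB-M⁺ for `(A,B,C∖{w}) ⊆ τ` when `w ∈ min(C) ∩ A ∩ B` (a third reduction move, towards the empty-bottom face). [this work] -/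
theorem sStarD_le_insert_bottom_of_mem (Au Bu Cu : Finset (Pd (n + 1))) (w : Pd n)
    (hA : IsUpperSet (Au : Set (Pd (n + 1)))) (hB : IsUpperSet (Bu : Set (Pd (n + 1))))
    (hAu : ∀ q : Pd n, ind Au (Fin.snoc q 1 : Pd (n + 1)) = ind Au (Fin.snoc q 2 : Pd (n + 1)))
    (hBu : ∀ q : Pd n, ind Bu (Fin.snoc q 1 : Pd (n + 1)) = ind Bu (Fin.snoc q 2 : Pd (n + 1)))
    (hCu : ∀ q : Pd n, ind Cu (Fin.snoc q 1 : Pd (n + 1)) = ind Cu (Fin.snoc q 2 : Pd (n + 1)))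
    (hw : (Fin.snoc w 0 : Pd (n + 1)) ∉ Cu)
    (hwA : (Fin.snoc w 0 : Pd (n + 1)) ∈ Au) (hwB : (Fin.snoc w 0 : Pd (n + 1)) ∈ Bu) :
    sStarD Au Bu Cu ≤ sStarD Au Bu (insert (Fin.snoc w 0 : Pd (n + 1)) Cu) := by
  have e := sStarD_insert_bottom_eq Au Bu Cu w hAu hBu hCu hw
  have hwA2 : (Fin.snoc w 2 : Pd (n + 1)) ∈ Au := hA (snoc_le_snoc_of_le w (by decide : (0:Fin 3) ≤ 2)) hwA
  have hwB2 : (Fin.snoc w 2 : Pd (n + 1)) ∈ Bu := hB (snoc_le_snoc_of_le w (by decide : (0:Fin 3) ≤ 2)) hwB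
  have iA0 : ind (univ.filter fun q : Pd n => (Fin.snoc q 0 : Pd (n + 1)) ∈ Au) w = 1 := by rw [ind_filter_snoc]; unfold ind; rw [if_pos hwA]
  have iB0 : ind (univ.filter fun q : Pd n => (Fin.snoc q 0 : Pd (n + 1)) ∈ Bu) w = 1 := by rw [ind_filter_snoc]; unfold ind; rw [if_pos hwB]
  have iA2 : ind (univ.filter fun q : Pd n => (Fin.snoc q 2 : Pd (n + 1)) ∈ Au) w = 1 := by rw [ind_filter_snoc]; unfold ind; rw [if_pos hwA2]
  have iB2 : ind (univ.filter fun q : Pd n => (Fin.snoc q 2 : Pd (n + 1)) ∈ Bu) w = 1 := by rw [ind_filter_snoc]; unfold ind; rw [if_pos hwB2]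
  -- the single-point functional is the y-profile at a meet point, hence ≥ 0
  have s := sStarD_singleton_first w (univ.filter fun q : Pd n => (Fin.snoc q 2 : Pd (n + 1)) ∈ Au) (univ.filter fun q : Pd n => (Fin.snoc q 2 : Pd (n + 1)) ∈ Bu)
  have P0 : 0 ≤ sStarD ({w} : Finset (Pd n)) (univ.filter fun q : Pd n => (Fin.snoc q 2 : Pd (n + 1)) ∈ Au) (univ.filter fun q : Pd n => (Fin.snoc q 2 : Pd (n + 1)) ∈ Bu) := by
    rw [sStarD_swap12, sStarD_swap23, sStarD_eq_sum_yProfile, Finset.sum_singleton]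
    exact yProfile_nonneg_of_mem (mem_inter.2 ⟨mem_filter.2 ⟨mem_univ _, hwA2⟩, mem_filter.2 ⟨mem_univ _, hwB2⟩⟩)
  rw [iA2, iB2] at s
  rw [iA0, iB0] at e
  nlinarith [e, s, P0]

end Summit.CriticalPhenomena.PercolationContinuityZ3.Theorems.SahiGridPattern
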